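/-
Copyright (c) 2026 the pub-hodgecm-mathlib formalisation cell (harness21).  Prover seat hodgecm-mathlib-LH4-p10 (g9) (valve hand), Track B «K2-LIT»,
#184♮ = hLiu418 = `stmt-HodgeConjecture-24832`; socket #41, KIND W, organ «Φ6b-ind» (R3)-G6 FILE 0 (KW desk F0P2-p08 (g4) 01:50:32Z «make the `Pic`-generic head
primary»): ★ K2E4-p11 `K2LiuKindWArchIndefiniteLetter`'s head at a GENERIC picture predicate — the non-Siegel-form branch of the G6 family.  Credit: the proof is ★
p864067's text with the picture hypothesis renamed.  THEOREMS ONLY (no `def`, no `instance`, no notation, no named-fact hypothesis, no `sorry`).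
-/
import Summits.HodgeConjecture.HodgeConjecture.Theorems.K2LiuKindWArchIndefiniteLetter   -- ★ p864067 (K2E4-p11): §0 letters, the imports of its road
import HarnessLib

/-!
# Crux `HLiu418`, socket #41, KIND W — (R3)-G6 FILE 0 `K2LiuKindWArchIndefiniteLetterPic`: the indefinite per-place Whittaker letter at a GENERIC picture predicate

Cell `hodgecm-mathlib`, crux item hLiu418 = `stmt-HodgeConjecture-24832` (helper lane `--supports … --as helper`, count-neutral).  ★ 2b (`…WhittakerGrowth` §2) states the
DEFINITE continuation at a generic picture predicate `Pic`; ★ p864067 states the INDEFINITE one at the `evalAt … Q` picture only.  The (3d-iv) consumer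
`stabUniform_of_atOne` (K2E3-p11) quantifies `∀ Pic, hKpic[Pic] → …`, so the G6 head needs the indefinite continuation at a generic `Pic` for the `g` WITHOUT a
Siegel-form decomposition: **`exists_twistedWhittaker_continuation_of_indef_pic`** — ★ p864067's statement and proof with `evalAt … Q` ↦ `Pic s F` (two token changes).
[Shimura1982, §4 Thm. 4.2] [Shimura1997, §16.4, §18.4] [KudlaRallis1994, §1].
HONEST LABEL.  Count-neutral helper; no new content beyond ★ p864067 (hypothesis-first on `hJet`, ★ by `hJet_holds`): `HC_CM` is proved only modulo the 7 printed citations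
(2 remaining named inputs: hLiu418 = `stmt-HodgeConjecture-24832`, h413 = `stmt-HodgeConjecture-24833`) until rung 0 closes.
-/

set_option autoImplicit false
set_option linter.dupNamespace false -- the mandated namespace repeats `HodgeConjecture.HodgeConjecture`

noncomputable section

open Complex Matrix MeasureTheory
open scoped ComplexConjugate ComplexOrder
open Literature.NumberTheory.ModularForms.SiegelUpperHalfSpace (moeb)

namespace Summit.HodgeConjecture.HodgeConjecture.Cruxes.HLiu418.K2LiuKindWArchIndefiniteLetterPic

open Summit.HodgeConjecture.HodgeConjecture.Cruxes.HLiu418.K2LiuHermTwoGammaDefs (hermTwo hermTwo_eq_of_isHermitian)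
open Summit.HodgeConjecture.HodgeConjecture.Cruxes.HLiu418.K2LiuHermTwoConfluentXiDefs (xiTwo)
open Summit.HodgeConjecture.HodgeConjecture.Cruxes.HLiu418.K2LiuHermTwoEtaDefs (hermTwo_add)
open Summit.HodgeConjecture.HodgeConjecture.Cruxes.HLiu418.K2LiuHermitianTubeCocycle (mul_mem_UJ J_mem)
open Summit.HodgeConjecture.HodgeConjecture.Cruxes.HLiu418.K2LiuHermitianTubeAction (exists_transl_levi_mul_stabilizer)
open Summit.HodgeConjecture.HodgeConjecture.Cruxes.HLiu418.K2LiuArchInducedTubeDefs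
open Summit.HodgeConjecture.HodgeConjecture.Cruxes.HLiu418.K2LiuU22CompactPictureDefs
open Summit.HodgeConjecture.HodgeConjecture.Cruxes.HLiu418.K2LiuArchWhittakerLeviEquivariance
open Summit.HodgeConjecture.HodgeConjecture.Cruxes.HLiu418.K2LiuArchIntertwiningScalarValue (integral_hermOfReal_eq)
open Summit.HodgeConjecture.HodgeConjecture.Cruxes.HLiu418.K2LiuArchBlockOfFrame (antidiag_letters antidiag_eq_J_mul_levi levi_mul_transl)
open Summit.HodgeConjecture.HodgeConjecture.Cruxes.HLiu418.K2LiuKFiniteSectionWhittakerAsXiDerivatives (exists_whittaker_eq_sum_iteratedDeriv_hLine_uniform)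
open Summit.HodgeConjecture.HodgeConjecture.Cruxes.HLiu418.K2LiuKindWArchIndefiniteLetter (det_re_conjTranspose_mul_mul_neg)

/-- **THE PER-PLACE ARCHIMEDEAN WHITTAKER LETTER AT AN INDEFINITE FRAMED INDEX, GENERIC PICTURE PREDICATE** — ★ K2E4-p11
`K2LiuKindWArchIndefiniteLetter.exists_twistedWhittaker_continuation_of_indef` VERBATIM with the compact-picture hypothesis `∀ v unitary, F(k_v) = evalAt v hv Q` replaced by an
arbitrary predicate `Pic s F` in BOTH the K-picture bridge `hKpic` and the conclusion (★ 2b′'s `Pic` currency; the proof reads the picture only through `hKpic`).  Data: the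
jet-continuation letter `hJet` FIRST (order `0` ★ `hJet_zero`; all orders ★ `K2LiuHermTwoXiJetContinuation.hJet_holds`), the weight `k`, the frame `x = (0 B; C 0) ∈ U(J)`, `g ∈ U(J)`,
a HERMITIAN index with `re det < 0`, the twist `eb` and `hKpic`.  CONCLUSION: `∃ Ew s₀`, `Ew` holomorphic on `{0 < re}`, `∫ F(x·n(b)·g)·eb(b) db = Ew s` for `s₀ < re s` and every
section `F ∈ I_w(s, χ_k)` with `Pic s F`.  Road = ★'s (frame algebra, chart, Iwasawa, Levi, ★ (V-4b) at `h₂ = Rᴴ h₁ R`, `hJet` per jet).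
[cite: Shimura1997, §16.4, §18.4] [cite: Shimura1982, §4 Thm. 4.2] [cite: KudlaRallis1994, §1] -/
theorem exists_twistedWhittaker_continuation_of_indef_pic
    (hJet : ∀ (h Θ : Matrix (Fin 2) (Fin 2) ℂ), hᴴ = h → h.det.re < 0 → Θᴴ = Θ → ∀ (e : ℕ) (a b : ℂ),
      ∃ (F : ℂ → ℂ) (s₀ : ℝ), DifferentiableOn ℂ F {s : ℂ | 0 < s.re} ∧
        ∀ s : ℂ, s₀ < s.re → F s = iteratedDeriv e (fun t : ℝ => xiTwo 1 (h + (t : ℂ) • Θ) (a + s) (b + s)) 0)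
    (k : ℤ) (_hk : -2 ≤ k) (Pic : ℂ → (Matrix (Fin 2 ⊕ Fin 2) (Fin 2 ⊕ Fin 2) ℂ → ℂ) → Prop) (B C : Matrix (Fin 2) (Fin 2) ℂ)
    (hx : (fromBlocks 0 B C 0 : Matrix (Fin 2 ⊕ Fin 2) (Fin 2 ⊕ Fin 2) ℂ)ᴴ * Matrix.J (Fin 2) ℂ * (fromBlocks 0 B C 0 : Matrix (Fin 2 ⊕ Fin 2) (Fin 2 ⊕ Fin 2) ℂ) =
      Matrix.J (Fin 2) ℂ)
    (g : Matrix (Fin 2 ⊕ Fin 2) (Fin 2 ⊕ Fin 2) ℂ) (hg : gᴴ * Matrix.J (Fin 2) ℂ * g = Matrix.J (Fin 2) ℂ)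
    (hidx : Matrix (Fin 2) (Fin 2) ℂ) (hherm : hidxᴴ = hidx) (hind : hidx.det.re < 0)
    (eb : Matrix (Fin 2) (Fin 2) ℂ → ℂ) (heb : ∀ b, eb b = cexp (-(2 * Real.pi * I) * (hidx * b).trace))
    (hKpic : ∀ k₀ : Matrix (Fin 2 ⊕ Fin 2) (Fin 2 ⊕ Fin 2) ℂ, k₀ᴴ * Matrix.J (Fin 2) ℂ * k₀ = Matrix.J (Fin 2) ℂ →
      moeb k₀ (I • (1 : Matrix (Fin 2) (Fin 2) ℂ)) = I • 1 →
      ∃ P : MvPolynomial (((Fin 2 ⊕ Fin 2) × (Fin 2 ⊕ Fin 2)) ⊕ ((Fin 2 ⊕ Fin 2) × (Fin 2 ⊕ Fin 2))) ℂ,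
        ∀ (s : ℂ) (F : Matrix (Fin 2 ⊕ Fin 2) (Fin 2 ⊕ Fin 2) ℂ → ℂ), IsArchSiegelSection (fun z : ℂ => (conj z / ((‖z‖ : ℝ) : ℂ)) ^ k) s F →
          Pic s F →
          ∀ u : Matrix (Fin 2 ⊕ Fin 2) (Fin 2 ⊕ Fin 2) ℂ, uᴴ * Matrix.J (Fin 2) ℂ * u = Matrix.J (Fin 2) ℂ → moeb u (I • (1 : Matrix (Fin 2) (Fin 2) ℂ)) = I • 1 →
            F (u * k₀) = MvPolynomial.eval (Sum.elim (fun pq => u pq.1 pq.2) (fun pq => conj (u pq.1 pq.2))) P) :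
    ∃ (Ew : ℂ → ℂ) (s₀ : ℝ), DifferentiableOn ℂ Ew {s : ℂ | 0 < s.re} ∧ ∀ s : ℂ, s₀ < s.re →
      ∀ F : Matrix (Fin 2 ⊕ Fin 2) (Fin 2 ⊕ Fin 2) ℂ → ℂ, IsArchSiegelSection (fun z : ℂ => (conj z / ((‖z‖ : ℝ) : ℂ)) ^ k) s F →
        Pic s F →
        ∫ r : Fin 2 → Fin 2 → ℝ, F ((fromBlocks 0 B C 0 : Matrix (Fin 2 ⊕ Fin 2) (Fin 2 ⊕ Fin 2) ℂ) * fromBlocks 1 (hermOfReal r) 0 1 * g) * eb (hermOfReal r) =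
          Ew s := by
  classical
  /- §0 frame letters -/
  obtain ⟨hCB, hBC⟩ := antidiag_letters hx
  have hC : C.det ≠ 0 := (Matrix.isUnit_det_of_left_inverse hBC).ne_zero
  have hCu : IsUnit C.det := isUnit_iff_ne_zero.2 hC
  have hCiC : C⁻¹ * C = 1 := Matrix.nonsing_inv_mul C hCu
  have hCCi : C * C⁻¹ = 1 := Matrix.mul_nonsing_inv C hCu
  have hm₀ := levi_mem hBC                                   -- `m₀ := diag(C, −B) ∈ U(J)`
  have hg' := mul_mem_UJ hm₀ hg                              -- `g' := m₀ · g ∈ U(J)`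
  /- §1 arch Iwasawa of `g'` and the K-picture of the `u₀`-translates -/
  obtain ⟨X₀, R, u₀, hX₀, hR, hRu, hu₀J, hu₀i, hg'eq⟩ := exists_transl_levi_mul_stabilizer hg'
  obtain ⟨P, hP⟩ := hKpic u₀ hu₀J hu₀i
  have hRRi : R * R⁻¹ = 1 := Matrix.mul_nonsing_inv R hRu
  have had : Rᴴ * R⁻¹ = 1 := by rw [hR, hRRi]
  have hRdet : R.det ≠ 0 := hRu.ne_zero
  /- §2 the two index changes: hermitian, `det.re < 0` -/
  set h₁ : Matrix (Fin 2) (Fin 2) ℂ := (C⁻¹)ᴴ * hidx * C⁻¹ with h₁def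
  set h₂ : Matrix (Fin 2) (Fin 2) ℂ := Rᴴ * h₁ * R with h₂def
  have hCidet : (C⁻¹).det ≠ 0 := (Matrix.isUnit_det_of_right_inverse hCiC).ne_zero
  have hh₁ : h₁.IsHermitian := Matrix.isHermitian_conjTranspose_mul_mul C⁻¹ (hherm : hidx.IsHermitian)
  have hh₂ : h₂.IsHermitian := Matrix.isHermitian_conjTranspose_mul_mul R hh₁
  have hdet₁ : h₁.det.re < 0 := det_re_conjTranspose_mul_mul_neg hind hCidet
  have hdet₂ : h₂.det.re < 0 := det_re_conjTranspose_mul_mul_neg hdet₁ hRdet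
  /- ★ (V-4b) at the hermitian `h₂`: `W_{h₂}(s; f)` as a finite combination of `h`-line jets of ξ; the jets' continuations by `hJet` -/
  obtain ⟨J, κ, m, n, s₀, hV⟩ := exists_whittaker_eq_sum_iteratedDeriv_hLine_uniform P k
  choose Fj s₁ hFjd hFj using fun j : (Σ _ : ((Fin 2 × Fin 2) ⊕ (Fin 2 × Fin 2)) →₀ ℕ, {M : Matrix (Fin 2) (Fin 2) ℂ // M.IsHermitian} × ℕ) =>
    hJet h₂ (j.2.1 : Matrix (Fin 2) (Fin 2) ℂ) hh₂ hdet₂ j.2.1.2 j.2.2 (1 - (k : ℂ) / 2 + (m j : ℂ)) (1 + (k : ℂ) / 2 + (n j : ℂ))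
  have hopen : IsOpen {s : ℂ | 0 < s.re} := isOpen_lt continuous_const Complex.continuous_re
  /- §3 the constants -/
  set χ : ℂ → ℂ := fun z : ℂ => (conj z / ((‖z‖ : ℝ) : ℂ)) ^ k with hχ
  set K₀ : ℂ := cexp ((2 * Real.pi * I) * (h₁ * X₀).trace) with hK₀
  have hRpos : 0 < ‖R.det‖ := norm_pos_iff.2 hRdet
  refine ⟨fun s => (1 / 8 : ℂ) * (((((‖C.det‖ : ℝ) : ℂ) ^ 4)⁻¹) * (K₀ * (χ R⁻¹.det * (((‖R.det‖ : ℝ) : ℂ) ^ (2 - 2 * s) * ∑ j ∈ J, κ j * Fj j s)))),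
    max s₀ (∑ j ∈ J, max (s₁ j) 0), ?_, fun s hs F hF hFQ => ?_⟩
  · -- holomorphy on `{0 < re}`
    have hpow : Differentiable ℂ (fun s : ℂ => ((‖R.det‖ : ℝ) : ℂ) ^ (2 - 2 * s)) :=
      Differentiable.const_cpow ((differentiable_const _).sub ((differentiable_const _).mul differentiable_id))
        (Or.inl (ofReal_ne_zero.2 hRpos.ne'))
    have hsum : DifferentiableOn ℂ (fun s : ℂ => ∑ j ∈ J, κ j * Fj j s) {s : ℂ | 0 < s.re} :=
      DifferentiableOn.fun_sum fun j _ => (differentiableOn_const _).mul (hFjd j)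
    exact (differentiableOn_const _).mul ((differentiableOn_const _).mul ((differentiableOn_const _).mul
      ((differentiableOn_const _).mul (hpow.differentiableOn.mul hsum))))
  · /- §4 the identity at `max s₀ (Σ_j max (s₁ j) 0) < re s` -/
    have hs₀ : s₀ < s.re := lt_of_le_of_lt (le_max_left _ _) hs
    have hs₁ : ∀ j ∈ J, s₁ j < s.re := fun j hj => by
      have h1 : max (s₁ j) 0 ≤ ∑ j ∈ J, max (s₁ j) 0 :=
        Finset.single_le_sum (f := fun j => max (s₁ j) 0) (fun _ _ => le_max_right _ _) hj
      have h2 := le_max_left (s₁ j) 0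
      have h3 := le_max_right s₀ (∑ j ∈ J, max (s₁ j) 0)
      linarith
    -- the right translate by `u₀` is a section with polynomial K-picture `P`
    set f : Matrix (Fin 2 ⊕ Fin 2) (Fin 2 ⊕ Fin 2) ℂ → ℂ := fun y => F (y * u₀) with hf
    have hfS : IsArchSiegelSection χ s f := isArchSiegelSection_rightTranslate hF u₀
    have hfK : ∀ u : Matrix (Fin 2 ⊕ Fin 2) (Fin 2 ⊕ Fin 2) ℂ, uᴴ * Matrix.J (Fin 2) ℂ * u = Matrix.J (Fin 2) ℂ →
        moeb u (I • (1 : Matrix (Fin 2) (Fin 2) ℂ)) = I • 1 →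
        f u = MvPolynomial.eval (Sum.elim (fun pq => u pq.1 pq.2) (fun pq => conj (u pq.1 pq.2))) P :=
      fun u hu hui => hP s F hF hFQ u hu hui
    -- the twist read at `h₁`: `eb X = e₁ (C X Cᴴ)`
    have heb₁ : ∀ X : Matrix (Fin 2) (Fin 2) ℂ, eb X = cexp (-(2 * Real.pi * I) * (h₁ * (C * X * Cᴴ)).trace) := by
      intro X
      rw [heb, trace_mul_conj h₁ C X, h₁def]
      congr 3
      rw [show Cᴴ * ((C⁻¹)ᴴ * hidx * C⁻¹) * C = (C⁻¹ * C)ᴴ * hidx * (C⁻¹ * C) by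
        rw [Matrix.conjTranspose_mul]; simp only [Matrix.mul_assoc], hCiC, Matrix.conjTranspose_one, Matrix.one_mul, Matrix.mul_one]
    -- the frame algebra: `x · n(X) · g = J · n(C X Cᴴ) · g'`
    have e1 : ∀ X : Matrix (Fin 2) (Fin 2) ℂ, (fromBlocks 0 B C 0 : Matrix (Fin 2 ⊕ Fin 2) (Fin 2 ⊕ Fin 2) ℂ) * fromBlocks 1 X 0 1 * g =
        Matrix.J (Fin 2) ℂ * fromBlocks 1 (C * X * Cᴴ) 0 1 * (fromBlocks C 0 0 (-B) * g) := by
      intro X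
      rw [antidiag_eq_J_mul_levi, Matrix.mul_assoc (Matrix.J (Fin 2) ℂ), levi_mul_transl hCB, ← Matrix.mul_assoc (Matrix.J (Fin 2) ℂ),
        Matrix.mul_assoc _ _ g]
    -- the Iwasawa rewriting: `J · n(Y) · g' = (J · n(Y + X₀) · m(R,R⁻¹)) · u₀`
    have e2 : ∀ Y : Matrix (Fin 2) (Fin 2) ℂ, Matrix.J (Fin 2) ℂ * fromBlocks 1 Y 0 1 * (fromBlocks C 0 0 (-B) * g) =
        Matrix.J (Fin 2) ℂ * fromBlocks 1 (Y + X₀) 0 1 * fromBlocks R 0 0 R⁻¹ * u₀ := by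
      intro Y
      have hn : (fromBlocks 1 Y 0 1 : Matrix (Fin 2 ⊕ Fin 2) (Fin 2 ⊕ Fin 2) ℂ) * fromBlocks 1 X₀ 0 1 = fromBlocks 1 (Y + X₀) 0 1 := by
        rw [fromBlocks_multiply]; simp [add_comm]
      rw [hg'eq, ← hn]
      simp only [Matrix.mul_assoc]
    -- the twisted integrand in the two charts
    set G : Matrix (Fin 2) (Fin 2) ℂ → ℂ := fun Y =>
      F (Matrix.J (Fin 2) ℂ * fromBlocks 1 Y 0 1 * (fromBlocks C 0 0 (-B) * g)) * cexp (-(2 * Real.pi * I) * (h₁ * Y).trace) with hG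
    set c₀ : ℝ × ℂ × ℝ := ((X₀ 0 0).re, X₀ 0 1, (X₀ 1 1).re) with hc₀
    have hX₀c : hermTwo c₀ = X₀ := hermTwo_eq_of_isHermitian hX₀
    set G₂ : ℝ × ℂ × ℝ → ℂ := fun c =>
      f (Matrix.J (Fin 2) ℂ * fromBlocks 1 (hermTwo c) 0 1 * fromBlocks R 0 0 R⁻¹) * cexp (-(2 * Real.pi * I) * (h₁ * hermTwo c).trace) * K₀ with hG₂
    -- Step A+B: chart and frame algebra, pointwise
    have hAB : ∀ X : Matrix (Fin 2) (Fin 2) ℂ,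
        F ((fromBlocks 0 B C 0 : Matrix (Fin 2 ⊕ Fin 2) (Fin 2 ⊕ Fin 2) ℂ) * fromBlocks 1 X 0 1 * g) * eb X = G (C * X * Cᴴ) := by
      intro X; rw [hG, e1, heb₁]
    -- Step D pointwise: `G (hermTwo c) = G₂ (c₀ + c)`
    have hD : ∀ c : ℝ × ℂ × ℝ, G (hermTwo c) = G₂ (c₀ + c) := by
      intro c
      have hY : hermTwo (c₀ + c) = hermTwo c + X₀ := by rw [hermTwo_add, hX₀c, add_comm]
      simp only [hG, hG₂, hf]
      rw [e2, hY, mul_assoc (F _)]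
      congr 1
      rw [hK₀, ← Complex.exp_add]
      congr 1
      rw [Matrix.mul_add, Matrix.trace_add]
      ring
    -- the jets at `h₂`, continued: `Σ_j κ_j · jet_j(s) = Σ_j κ_j · F_j(s)`
    have hJ : ∑ j ∈ J, κ j * iteratedDeriv j.2.2
          (fun t : ℝ => xiTwo 1 (h₂ + (t : ℂ) • (j.2.1 : Matrix (Fin 2) (Fin 2) ℂ)) (s + 1 - k / 2 + m j) (s + 1 + k / 2 + n j)) 0 =
        ∑ j ∈ J, κ j * Fj j s := by
      refine Finset.sum_congr rfl fun j hj => ?_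
      have ea : 1 - (k : ℂ) / 2 + (m j : ℂ) + s = s + 1 - k / 2 + m j := by ring
      have eb' : 1 + (k : ℂ) / 2 + (n j : ℂ) + s = s + 1 + k / 2 + n j := by ring
      rw [hFj j s (hs₁ j hj), ea, eb']
    -- Lebesgue measure on the chart `ℝ × ℂ × ℝ` is an additive Haar measure (as in ★ `integral_hermOfReal_eq`)
    haveI hCvol : ((volume : Measure ℂ).prod (volume : Measure ℝ)).IsAddHaarMeasure := Measure.prod.instIsAddHaarMeasure _ _
    haveI : (volume : Measure (ℝ × ℂ × ℝ)).IsAddHaarMeasure := by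
      rw [show (volume : Measure (ℝ × ℂ × ℝ)) = (volume : Measure ℝ).prod ((volume : Measure ℂ).prod (volume : Measure ℝ)) from rfl]
      exact Measure.prod.instIsAddHaarMeasure _ _
    calc ∫ r : Fin 2 → Fin 2 → ℝ, F ((fromBlocks 0 B C 0 : Matrix (Fin 2 ⊕ Fin 2) (Fin 2 ⊕ Fin 2) ℂ) * fromBlocks 1 (hermOfReal r) 0 1 * g) * eb (hermOfReal r)
        = (1 / 8 : ℂ) * ∫ c : ℝ × ℂ × ℝ, G (C * hermTwo c * Cᴴ) := by
          rw [integral_hermOfReal_eq (fun X => F ((fromBlocks 0 B C 0 : Matrix (Fin 2 ⊕ Fin 2) (Fin 2 ⊕ Fin 2) ℂ) * fromBlocks 1 X 0 1 * g) * eb X)]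
          simp only [hAB]
      _ = (1 / 8 : ℂ) * ((((‖C.det‖ : ℝ) : ℂ) ^ 4)⁻¹ * ∫ c : ℝ × ℂ × ℝ, G (hermTwo c)) := by
          congr 1
          rw [integral_comp_hermTwo_conj hC G, Complex.real_smul, ofReal_pow, ← mul_assoc,
            inv_mul_cancel₀ (pow_ne_zero _ (ofReal_ne_zero.2 (norm_pos_iff.2 hC).ne')), one_mul]
      _ = (1 / 8 : ℂ) * ((((‖C.det‖ : ℝ) : ℂ) ^ 4)⁻¹ * ∫ c : ℝ × ℂ × ℝ, G₂ c) := by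
          simp only [hD]
          rw [integral_add_left_eq_self G₂ c₀]
      _ = (1 / 8 : ℂ) * ((((‖C.det‖ : ℝ) : ℂ) ^ 4)⁻¹ * (K₀ *
            ∫ c : ℝ × ℂ × ℝ, f (Matrix.J (Fin 2) ℂ * fromBlocks 1 (hermTwo c) 0 1 * fromBlocks R 0 0 R⁻¹) *
              cexp (-(2 * Real.pi * I) * (h₁ * hermTwo c).trace))) := by
          rw [hG₂, integral_mul_const, mul_comm _ K₀]
      _ = (1 / 8 : ℂ) * ((((‖C.det‖ : ℝ) : ℂ) ^ 4)⁻¹ * (K₀ * (χ R⁻¹.det * (((‖R.det‖ : ℝ) : ℂ) ^ (2 - 2 * s) *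
            ∫ c : ℝ × ℂ × ℝ, f (Matrix.J (Fin 2) ℂ * fromBlocks 1 (hermTwo c) 0 1) * cexp (-(2 * Real.pi * I) * (h₂ * hermTwo c).trace))))) := by
          rw [whittaker_levi_equivariance hfS had h₁, h₂def, mul_assoc (χ R⁻¹.det)]
      _ = (1 / 8 : ℂ) * ((((‖C.det‖ : ℝ) : ℂ) ^ 4)⁻¹ * (K₀ * (χ R⁻¹.det * (((‖R.det‖ : ℝ) : ℂ) ^ (2 - 2 * s) * ∑ j ∈ J, κ j * Fj j s)))) := by
          rw [hV h₂ hh₂ s hs₀ f hfS hfK, hJ]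

end Summit.HodgeConjecture.HodgeConjecture.Cruxes.HLiu418.K2LiuKindWArchIndefiniteLetterPic

end
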